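import Literature.Topology.FourManifolds.HCobordismBasisTheorem
import Literature.Topology.FourManifolds.HCobordismMorseComplex
import Literature.Topology.FourManifolds.HCobordismMorseHomologyFree
import Literature.Topology.FourManifolds.HCobordismMorseHomologyConcentration
import Literature.Topology.FourManifolds.HCobordismIntersectionNumberSlab
import Literature.Topology.FourManifolds.HCobordismLevelConnectivityProofs
import Literature.Topology.FourManifolds.HCobordismMiddleStepProofs
import Literature.Topology.FourManifolds.RearrangementSlabProofs
import HarnessLib

/-!
# The intersection numbers `S_R(pⱼ) · S_L(qᵢ) = ±δᵢⱼ` for a two-three handlebody of an h-cobordism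

For a nice Morse function `g` with critical points of index `2` and `3` only on a simply
connected h-cobordism `c` of dimension `5 = 4 + 1` (Kirby 1996, §2; Matveyev 1996), this file
proves — relative to Milnor's Basis Theorem 7.6 on a slab
(`Literature.Topology.FourManifolds.Cobordism.Milnor1965_basisTheorem_slab`, hypothesis `h76`)
and to Milnor's Lemma 7.2 on a slab in the exact shape of the hypothesis `h72` of
`Literature.Topology.FourManifolds.Cobordism.Milnor1965_intersectionNumber_slab_of_sphereClass` —
the homological heart of the last paragraph of Kirby's §2: after handle slides (7.6 applied on
`c₂` and on `c₃`, with the basis `e' = ∂⁻¹ e` of `C₃`, `∂ : C₃ → C₂` being an isomorphism for an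
h-cobordism by Thm. 7.4), the right-hand spheres `S_R(pⱼ)` of the index-2 points and the
left-hand spheres `S_L(qᵢ)` of the index-3 points in the middle level `g⁻¹(1/2)` have
intersection numbers `S_R(pⱼ) · S_L(qᵢ) = ±δᵢⱼ`, for every smooth gradient-like field that agrees
with the slid one off a thin slab under the middle level, every presentation of the level and of
the spheres, and all orientations (Milnor 1965, proof of Thm. 7.8, PDF p. 53: *"by Theorem 7.6 we
may assume ⟨x'₁⟩ → ±⟨x₁⟩, S_R(p) · S_L(q) = ±1"*, here for the whole boundary matrix
`∂ = identity`: *"the algebraic intersection number between the ascending 2-spheres and the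
descending 2-spheres in the level between the 2- and 3-handles is δᵢⱼ"*, Matveyev 1996, ¶1).

* `Literature.Topology.FourManifolds.Cobordism.IsHCobordism.bijective_morseBoundary_two` —
  `∂ : C₃ → C₂` is bijective (Thm. 7.4 with `H⁎(W, V) = 0`, `C₁ = C₄ = 0`), PROVED;
* `Literature.Topology.FourManifolds.IsGradientLike.mem_stableSet_of_eqOn_ge` — stable sets above a
  level are unchanged by altering the field below it, PROVED;
* `Literature.Topology.FourManifolds.two_three_intersectionNumbers_of_basisTheorem_of_lemma72` —
  the main result, PROVED from `h76` and `h72` (Milnor 7.6 twice; Thms. 4.1/4.2 on a slab,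
  Cor. 3.15 on a one-level slab and the identification of PDF p. 46, all proved in the tree;
  naturality of the connecting homomorphisms; Lemma 7.2).

## References

* [KirbyCorks1996] R. Kirby, *Akbulut's corks and h-cobordisms of smooth, simply connected
  4-manifolds*, Turkish J. Math. 20 (1996), 85–93, arXiv:math/9712231, §2 (last paragraph).
* [Matveyev1996] R. Matveyev, *A decomposition of smooth simply-connected h-cobordant
  4-manifolds*, J. Differential Geom. 44 (1996), 571–582, ¶1 of the proof.
* [MilnorHCobordism1965] J. Milnor, *Lectures on the h-cobordism theorem*, Princeton Univ. Press,
  1965: Thm. 3.13 and p. 21, Cor. 3.15, Thms. 4.1/4.2, Lemma 7.2, Cor. 7.3, Thm. 7.4, Thm. 7.6,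
  proof of Thm. 7.8 (PDF pp. 18–23, 46–53).
-/

open scoped Manifold ContDiff Topology
open Set Function Filter CategoryTheory Limits
open Literature.AlgebraicTopology.SingularHomology

noncomputable section

namespace Literature.Topology.FourManifolds

universe u

section BoundaryIso

variable {X₁ X₂ : Type u} [TopologicalSpace X₁] [T2Space X₁] [SecondCountableTopology X₁]
  [ChartedSpace (EuclideanSpace ℝ (Fin 4)) X₁] [IsManifold (𝓡 4) ∞ X₁] [CompactSpace X₁]
  [TopologicalSpace X₂] [T2Space X₂] [SecondCountableTopology X₂]
  [ChartedSpace (EuclideanSpace ℝ (Fin 4)) X₂] [IsManifold (𝓡 4) ∞ X₂] [CompactSpace X₂]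

/-- **`∂ : C₃ → C₂` is an isomorphism for a nice two-three Morse function on an h-cobordism of
dimension `5`** (Milnor 1965, Thm. 7.4 with `H⁎(W, V) = 0`: the complex
`0 = C₄ → C₃ →∂ C₂ → C₁ = 0` is exact; Kirby 1996, §2: *"the boundary map from 3-chains to
2-chains […] is given by"* an invertible matrix).  The chain groups `C_k = H_k(W_k, W_{k-1})`
and `∂` are the tree's `Cobordism.morseHomology`, `Cobordism.morseBoundary`; `C₁`, `C₄` vanish
because there are no critical points of index `1`, `4` (Cor. 3.15 ranks,
`Milnor1965_morseHomology_free_holds`), and Thm. 7.4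
(`Cobordism.Milnor1965_morseComplex_homology_holds`) with
`Cobordism.IsHCobordism.isZero_relativeSingularHomology` gives exactness at `C₂` and `C₃`.
[cite: MilnorHCobordism1965, Thm. 7.4 (PDF p. 48), proof of Thm. 7.8 (PDF p. 53)] [cite: KirbyCorks1996, §2] -/
theorem Cobordism.IsHCobordism.bijective_morseBoundary_two {c : Cobordism 4 X₁ X₂} (hc : c.IsHCobordism)
    {g : c.W → ℝ} (hg : c.IsNiceMorseFunction g)
    (h23 : ∀ z ∈ criticalSet (𝓡∂ (4 + 1)) g, morseIndex (𝓡∂ (4 + 1)) g z = 2 ∨ morseIndex (𝓡∂ (4 + 1)) g z = 3) :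
    Function.Bijective (c.morseBoundary g 2 2).hom := by
  have hgM : c.IsMorseFunction g := hg.1
  -- `C₁ = 0` and `C₄ = 0`
  have hempty : ∀ k, k ≠ 2 → k ≠ 3 → criticalSetOfIndex (𝓡∂ (4 + 1)) g k = ∅ := by
    intro k h2 h3
    ext z
    simp only [mem_criticalSetOfIndex, mem_empty_iff_false, iff_false, not_and]
    intro hz hidx
    rcases h23 z hz with h | h <;> omega
  obtain ⟨-, hF1, hFin1, hrk1⟩ := Milnor1965_morseHomology_free_holds hg 1
  obtain ⟨-, hF4, hFin4, hrk4⟩ := Milnor1965_morseHomology_free_holds hg 4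
  haveI hsub1 : Subsingleton (c.morseHomology g 1 1) := by
    rw [← Module.finrank_eq_zero_iff_of_free ℤ, hrk1, hempty 1 (by norm_num) (by norm_num), ncard_empty]
  haveI hsub4 : Subsingleton (c.morseHomology g 4 4) := by
    rw [← Module.finrank_eq_zero_iff_of_free ℤ, hrk4, hempty 4 (by norm_num) (by norm_num), ncard_empty]
  -- exactness at `C₂` and at `C₃` (Thm. 7.4 and `H⁎(W, V) = 0`)
  obtain ⟨iso₁⟩ := Cobordism.Milnor1965_morseComplex_homology_holds hg 1
  obtain ⟨iso₂⟩ := Cobordism.Milnor1965_morseComplex_homology_holds hg 2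
  have hexact₁ : (c.morseComplexAt g 1).Exact := by
    rw [ShortComplex.exact_iff_isZero_homology]
    exact IsZero.of_iso (hc.isZero_relativeSingularHomology (1 + 1)) iso₁
  have hexact₂ : (c.morseComplexAt g 2).Exact := by
    rw [ShortComplex.exact_iff_isZero_homology]
    exact IsZero.of_iso (hc.isZero_relativeSingularHomology (2 + 1)) iso₂
  refine ⟨?_, ?_⟩
  · -- one-to-one: the kernel is the image of `C₄ = 0`
    rw [injective_iff_map_eq_zero]
    intro y hy
    obtain ⟨x, hx⟩ := (ShortComplex.moduleCat_exact_iff _).mp hexact₂ y hy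
    rw [← hx, Subsingleton.elim x 0, map_zero]
  · -- onto: the cokernel embeds in `C₁ = 0`
    intro y
    obtain ⟨x, hx⟩ := (ShortComplex.moduleCat_exact_iff _).mp hexact₁ y (Subsingleton.elim _ _)
    exact ⟨x, hx⟩

end BoundaryIso

/-! ### Stable sets under an alteration of the field below a level -/

section StableBelow

variable {m : ℕ} {H : Type*} [TopologicalSpace H] {J : ModelWithCorners ℝ (EuclideanSpace ℝ (Fin m)) H}
  {M : Type*} [TopologicalSpace M] [ChartedSpace H M]
  {f : M → ℝ} {ξ ξ' : Π x : M, TangentSpace J x} {q y : M} {t : ℝ}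

/-- **A trajectory of a gradient-like field starting at a point of `{f ≥ t}` and going to `q` is
a trajectory of any field which agrees with it on `{f ≥ t}`** (`f` increases along it), so the
points of `{f ≥ t}` in the stable set of `q` are the same for a field altered only below the
level `t` (Milnor, Lemma 4.7: the alteration `ξ̄ = ξ` outside `f⁻¹(a, b)` leaves the left-hand
spheres in the levels `≥ b` in place). [cite: MilnorHCobordism1965, Lemma 4.7 (PDF p. 25)] -/
theorem IsGradientLike.mem_stableSet_of_eqOn_ge (h : IsGradientLike J f ξ)
    (hf : MDifferentiable J 𝓘(ℝ, ℝ) f) (heq : ∀ z, t ≤ f z → ξ' z = ξ z) (hy : t ≤ f y)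
    (hyq : y ∈ stableSet J ξ q) : y ∈ stableSet J ξ' q := by
  obtain ⟨γ, h0, hγ, hlim⟩ := hyq
  refine ⟨γ, h0, fun s hs => ?_, hlim⟩
  have hmono := h.monotoneOn_comp hf (convex_Ici 0) hγ
  have hs' : t ≤ f (γ s) := by
    have := hmono self_mem_Ici hs hs
    rw [comp_apply, h0] at this
    exact hy.trans this
  have := hγ s hs
  rwa [← heq _ hs'] at this

end StableBelow

/-! ### The boundary matrix after handle slides (Milnor Thm. 7.6 twice, with `∂ e'ᵢ = eᵢ`) -/

section Slides

variable {X₁ X₂ : Type u} [TopologicalSpace X₁] [T2Space X₁] [SecondCountableTopology X₁]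
  [ChartedSpace (EuclideanSpace ℝ (Fin 4)) X₁] [IsManifold (𝓡 4) ∞ X₁] [CompactSpace X₁]
  [TopologicalSpace X₂] [T2Space X₂] [SecondCountableTopology X₂]
  [ChartedSpace (EuclideanSpace ℝ (Fin 4)) X₂] [IsManifold (𝓡 4) ∞ X₂] [CompactSpace X₂]

set_option maxHeartbeats 3200000 in
/-- **The intersection numbers `S_R(pⱼ) · S_L(qᵢ) = ±δᵢⱼ` in the middle level of a two-three
handlebody of a simply connected h-cobordism of dimension `5`, after handle slides** (Kirby 1996,
§2, last paragraph; Matveyev 1996, ¶1; Milnor 1965, proof of Thm. 7.8 from Thms. 7.4, 7.6 and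
Lemma 7.2), relative to the Basis Theorem 7.6 on a slab (`h76`) and Lemma 7.2 on a slab (`h72`,
the hypothesis of
`Literature.Topology.FourManifolds.Cobordism.Milnor1965_intersectionNumber_slab_of_sphereClass`).
Given a nice Morse function `g` with all critical points of index `2` or `3` and a smooth
gradient-like `ξ` on an h-cobordism `c` (`W` simply connected) between closed `4`-manifolds,
there are a Morse function `g₂` and a smooth gradient-like `ξ₂`, equal to `g`, `ξ` near the middle
level `g⁻¹(1/2)` (and `g₂⁻¹(1/2) = g⁻¹(1/2)`), with the same critical points and indices, the index-`2` points
`σ 0, …, σ (a-1)` on one level `v₂ ∈ (1/3, 1/2)` and the index-`3` points `τ 0, …, τ (a-1)` on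
one level `v₃ ∈ (1/2, 2/3)` (the same number `a = rank C₂ = rank C₃` of each), such that for
EVERY smooth gradient-like field `ξ₃` for `g₂` agreeing with `ξ₂` off `g₂⁻¹(v₂, 1/2)`, every
presentation `ι : V → W` of the middle level `g₂⁻¹(1/2)`, every pair `(j, i)`, all smooth
embeddings `e_R, e_L : S² → V` presenting the right-hand sphere of `σ j` and the left-hand sphere
of `τ i` for `ξ₃`, meeting transversely in finitely many points, and all orientations, the
intersection number `e_R · e_L` (Def. 6.1) is `±1` if `i = j` and `0` if `i ≠ j`.
Proof (Milnor, PDF pp. 48–53): `∂ : C₃ → C₂` is bijective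
(`Cobordism.IsHCobordism.bijective_morseBoundary_two`); take a basis `e` of `C₂` and
`e' = ∂⁻¹ e`; Thm. 7.6 on `c₂ = g⁻¹[1/3, 1/2]` realises `e` by the left-hand discs of the index-2
points (enumerated `σ`) for `(g', ξ')`, and then on `c₃ = g'⁻¹[1/2, 2/3]` realises `e'` by the
left-hand discs of the index-3 points (`τ`) for `(g₂, ξ₂)`.  For a pair `(j, i)` and a field
`ξ₃` as above, raise `p = σ j` alone to a level just under `1/2` by Thms. 4.1/4.2 keeping `ξ₃`
(`Cobordism.exists_isolate_criticalPt_of_parts`), obtaining `g₄`; with `A = {g₄ ≤ a₀}` just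
under `p`, the map `ρ : C₂ = H₂(B, W₋) → H₂(B, A) ≅ ℤ` (`B = {g ≤ 1/2}`, Cor. 3.15) kills
`e_m`, `m ≠ j` (their discs lie in `A`, the fields agreeing below) and is onto, so `ρ e_j`
generates; by naturality of the connecting homomorphisms, `e_i = ∂ e'_i` is the image of the
class `s_i = δ γ'_i ∈ H₂(S_L(τ i))` of the boundary of the disc of `τ i`, a NON-ZERO multiple
`m σ₀` of the generator of `H₂(S_L) ≅ ℤ` (`e_i ≠ 0`); Lemma 7.2 on the slab `g₄⁻¹[a₀, 1/2]`
(read in `H₂(B, A)` through the isomorphism of PDF p. 46) gives `image(σ₀) = (e_R · e_L) u`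
with `u` a generator; comparing, `m (e_R · e_L) (±1) = δᵢⱼ`, whence the claim.
[cite: KirbyCorks1996, §2 (last paragraph)] [cite: Matveyev1996, ¶1]
[cite: MilnorHCobordism1965, Thm. 7.4 (PDF p. 48), Thm. 7.6 (PDF p. 50), Lemma 7.2 and Cor. 7.3 (PDF pp. 46–47), proof of Thm. 7.8 (PDF p. 53), Thms. 4.1–4.2 (PDF pp. 22–23), Cor. 3.15 (PDF p. 19)] -/
theorem two_three_intersectionNumbers_of_basisTheorem_of_lemma72
    (h76 : Cobordism.Milnor1965_basisTheorem_slab.{u})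
    (h72 : ∀ {n : ℕ} {M N : Type u} [TopologicalSpace M] [T2Space M] [SecondCountableTopology M]
      [ChartedSpace (EuclideanSpace ℝ (Fin n)) M] [IsManifold (𝓡 n) ∞ M] [CompactSpace M]
      [TopologicalSpace N] [T2Space N] [SecondCountableTopology N] [ChartedSpace (EuclideanSpace ℝ (Fin n)) N]
      [IsManifold (𝓡 n) ∞ N] [CompactSpace N] {c : Cobordism n M N} {f : c.W → ℝ}
      (_ : c.IsMorseFunction f)
      (ξ : Cₛ^∞⟮𝓡∂ (n + 1); EuclideanSpace ℝ (Fin (n + 1)), (TangentSpace (𝓡∂ (n + 1)) : c.W → Type)⟯)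
      (_ : IsGradientLike (𝓡∂ (n + 1)) f ξ) {a₀ b : ℝ} (_ : 0 < a₀) (_ : b < 1)
      {p : c.W} {k j : ℕ} (hkj : k + j = n) (_ : 2 ≤ k) (_ : k + 2 ≤ n)
      (_ : p ∈ criticalSetOfIndex (𝓡∂ (n + 1)) f k) (_ : a₀ < f p) (_ : f p < b)
      (_ : ∀ z ∈ criticalSet (𝓡∂ (n + 1)) f, f z ∈ Icc a₀ b → z = p)
      (V : Type u) [TopologicalSpace V] [T2Space V] [SecondCountableTopology V] [CompactSpace V]
      [ChartedSpace (EuclideanSpace ℝ (Fin n)) V] [IsManifold (𝓡 n) ∞ V] (ι : V → c.W)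
      (_ : Manifold.IsSmoothEmbedding (𝓡 n) (𝓡∂ (n + 1)) ∞ ι) (_ : range ι = f ⁻¹' {b})
      (eR : Metric.sphere (0 : EuclideanSpace ℝ (Fin (j + 1))) 1 → V)
      (_ : Manifold.IsSmoothEmbedding (𝓡 j) (𝓡 n) ∞ eR)
      (_ : range (ι ∘ eR) = rightHandSphere (𝓡∂ (n + 1)) f ξ p b)
      (eL : Metric.sphere (0 : EuclideanSpace ℝ (Fin (k + 1))) 1 → V)
      (_ : Manifold.IsSmoothEmbedding (𝓡 k) (𝓡 n) ∞ eL)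
      (T : Set c.W) (_ : range (ι ∘ eL) = T) (hT : T ⊆ f ⁻¹' Icc a₀ b)
      (_ : (doublePoints eR eL).Finite)
      (_ : MapsTransverse (𝓡 j) (𝓡 k) (𝓡 n) (Nat.add_comm j k ▸ hkj) eR eL)
      (oV : SmoothOrientation (𝓡 n) V) (oR : SmoothOrientation (𝓡 j) (Metric.sphere (0 : EuclideanSpace ℝ (Fin (j + 1))) 1))
      (oL : SmoothOrientation (𝓡 k) (Metric.sphere (0 : EuclideanSpace ℝ (Fin (k + 1))) 1))
      (σ : singularHomology ℤ ℤ ↥T k) (_ : ∃ e : singularHomology ℤ ℤ ↥T k ≃ₗ[ℤ] ℤ, e σ = 1),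
      ∃ u : relativeSingularHomology ℤ ℤ ↥(f ⁻¹' Icc a₀ b) {z | f z.1 = a₀} k,
        (∃ e : relativeSingularHomology ℤ ℤ ↥(f ⁻¹' Icc a₀ b) {z | f z.1 = a₀} k ≃ₗ[ℤ] ℤ,
          e u = 1) ∧
        (singularHomology.map ℤ ℤ (subsetInclusion hT) k ≫
            relativeSingularHomology.ofAbsolute ℤ ℤ ↥(f ⁻¹' Icc a₀ b) {z | f z.1 = a₀} k) σ =
          intersectionNumber (𝓡 j) (𝓡 k) (𝓡 n) (Nat.add_comm j k ▸ hkj) oR oL oV eR eL • u)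
    {c : Cobordism 4 X₁ X₂} (hc : c.IsHCobordism) (hW : SimplyConnectedSpace c.W)
    {g : c.W → ℝ} (hg : c.IsNiceMorseFunction g)
    (h23 : ∀ z ∈ criticalSet (𝓡∂ (4 + 1)) g, morseIndex (𝓡∂ (4 + 1)) g z = 2 ∨ morseIndex (𝓡∂ (4 + 1)) g z = 3)
    (ξ : Cₛ^∞⟮𝓡∂ (4 + 1); EuclideanSpace ℝ (Fin (4 + 1)), (TangentSpace (𝓡∂ (4 + 1)) : c.W → Type)⟯)
    (hξ : IsGradientLike (𝓡∂ (4 + 1)) g ξ) :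
    ∃ (g₂ : c.W → ℝ) (ξ₂ : Cₛ^∞⟮𝓡∂ (4 + 1); EuclideanSpace ℝ (Fin (4 + 1)), (TangentSpace (𝓡∂ (4 + 1)) : c.W → Type)⟯)
      (a : ℕ) (σ τ : Fin a → c.W) (v₂ v₃ : ℝ),
      c.IsMorseFunction g₂ ∧ IsGradientLike (𝓡∂ (4 + 1)) g₂ ξ₂ ∧
      criticalSet (𝓡∂ (4 + 1)) g₂ = criticalSet (𝓡∂ (4 + 1)) g ∧
      (∀ z ∈ criticalSet (𝓡∂ (4 + 1)) g, morseIndex (𝓡∂ (4 + 1)) g₂ z = morseIndex (𝓡∂ (4 + 1)) g z) ∧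
      (∀ᶠ z in 𝓝ˢ (g ⁻¹' {2⁻¹}), g₂ z = g z ∧ ξ₂ z = ξ z) ∧ g₂ ⁻¹' {2⁻¹} = g ⁻¹' {2⁻¹} ∧
      (3⁻¹ < v₂ ∧ v₂ < 2⁻¹ ∧ 2⁻¹ < v₃ ∧ v₃ < 3⁻¹ * 2) ∧
      Injective σ ∧ range σ = criticalSetOfIndex (𝓡∂ (4 + 1)) g 2 ∧ (∀ i, g₂ (σ i) = v₂) ∧
      Injective τ ∧ range τ = criticalSetOfIndex (𝓡∂ (4 + 1)) g 3 ∧ (∀ i, g₂ (τ i) = v₃) ∧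
      ∀ (ξ₃ : Cₛ^∞⟮𝓡∂ (4 + 1); EuclideanSpace ℝ (Fin (4 + 1)), (TangentSpace (𝓡∂ (4 + 1)) : c.W → Type)⟯),
        IsGradientLike (𝓡∂ (4 + 1)) g₂ ξ₃ → (∀ z, g₂ z ∉ Ioo v₂ 2⁻¹ → ξ₃ z = ξ₂ z) →
        ∀ (V : Type u) [TopologicalSpace V] [T2Space V] [SecondCountableTopology V] [CompactSpace V]
          [ChartedSpace (EuclideanSpace ℝ (Fin 4)) V] [IsManifold (𝓡 4) ∞ V] (ι : V → c.W),
          Manifold.IsSmoothEmbedding (𝓡 4) (𝓡∂ (4 + 1)) ∞ ι → range ι = g₂ ⁻¹' {2⁻¹} →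
        ∀ (j i : Fin a) (eR : (Metric.sphere (0 : EuclideanSpace ℝ (Fin 3)) 1) → V), Manifold.IsSmoothEmbedding (𝓡 2) (𝓡 4) ∞ eR →
          range (ι ∘ eR) = rightHandSphere (𝓡∂ (4 + 1)) g₂ ξ₃ (σ j) 2⁻¹ →
        ∀ (eL : (Metric.sphere (0 : EuclideanSpace ℝ (Fin 3)) 1) → V), Manifold.IsSmoothEmbedding (𝓡 2) (𝓡 4) ∞ eL →
          range (ι ∘ eL) = leftHandSphere (𝓡∂ (4 + 1)) g₂ ξ₃ (τ i) 2⁻¹ →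
          (doublePoints eR eL).Finite → MapsTransverse (𝓡 2) (𝓡 2) (𝓡 4) two_add_two_eq_four eR eL →
        ∀ (oV : SmoothOrientation (𝓡 4) V) (oR oL : SmoothOrientation (𝓡 2) (Metric.sphere (0 : EuclideanSpace ℝ (Fin 3)) 1)),
          (i = j → intersectionNumber (𝓡 2) (𝓡 2) (𝓡 4) two_add_two_eq_four oR oL oV eR eL = 1 ∨
            intersectionNumber (𝓡 2) (𝓡 2) (𝓡 4) two_add_two_eq_four oR oL oV eR eL = -1) ∧
          (i ≠ j → intersectionNumber (𝓡 2) (𝓡 2) (𝓡 4) two_add_two_eq_four oR oL oV eR eL = 0) := by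
  classical
  ----------------------------------------------------------------------------------------------
  -- Levels: `t₀ = 1/3 < ν₀ = 5/12 < t₁ = 1/2 < ν₁ = 7/12 < t₂ = 2/3`.
  ----------------------------------------------------------------------------------------------
  set t₀ : ℝ := Cobordism.cutLevel 4 2 with ht₀d
  set t₁ : ℝ := Cobordism.cutLevel 4 3 with ht₁d
  set t₂ : ℝ := Cobordism.cutLevel 4 4 with ht₂d
  set ν₀ : ℝ := Cobordism.niceLevel 4 2 with hν₀d
  set ν₁ : ℝ := Cobordism.niceLevel 4 3 with hν₁d
  have ht₀v : t₀ = 3⁻¹ := by rw [ht₀d, Cobordism.cutLevel]; norm_num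
  have ht₁v : t₁ = 2⁻¹ := by rw [ht₁d, Cobordism.cutLevel]; norm_num
  have ht₂v : t₂ = 3⁻¹ * 2 := by rw [ht₂d, Cobordism.cutLevel]; norm_num
  have hν₀v : ν₀ = 5 / 12 := by rw [hν₀d]; norm_num [Cobordism.niceLevel]
  have hν₁v : ν₁ = 7 / 12 := by rw [hν₁d]; norm_num [Cobordism.niceLevel]
  have ht0 : 0 < t₀ := by rw [ht₀v]; norm_num
  have ht₀ν₀ : t₀ < ν₀ := by rw [ht₀v, hν₀v]; norm_num
  have hν₀t₁ : ν₀ < t₁ := by rw [ht₁v, hν₀v]; norm_num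
  have ht₁ν₁ : t₁ < ν₁ := by rw [ht₁v, hν₁v]; norm_num
  have hν₁t₂ : ν₁ < t₂ := by rw [ht₂v, hν₁v]; norm_num
  have ht₂1 : t₂ < 1 := by rw [ht₂v]; norm_num
  have ht₀t₁ : t₀ < t₁ := ht₀ν₀.trans hν₀t₁
  have ht₁t₂ : t₁ < t₂ := ht₁ν₁.trans hν₁t₂
  have ht₁1 : t₁ < 1 := ht₁t₂.trans ht₂1
  have hgM : c.IsMorseFunction g := hg.1
  ----------------------------------------------------------------------------------------------
  -- Step 0: the bases `e` of `C₂` and `e' = ∂⁻¹ e` of `C₃`.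
  ----------------------------------------------------------------------------------------------
  obtain ⟨-, hF2, hFin2, hrk2⟩ := Cobordism.Milnor1965_morseHomology_free_holds hg 2
  set a : ℕ := Module.finrank ℤ (c.morseHomology g 2 2) with had
  let e : Module.Basis (Fin a) ℤ (c.morseHomology g 2 2) := Module.finBasis ℤ _
  let dE : c.morseHomology g 3 3 ≃ₗ[ℤ] c.morseHomology g 2 2 :=
    LinearEquiv.ofBijective (c.morseBoundary g 2 2).hom (hc.bijective_morseBoundary_two hg h23)
  let e' : Module.Basis (Fin a) ℤ (c.morseHomology g 3 3) := e.map dE.symm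
  have hrel : ∀ i, (c.morseBoundary g 2 2).hom (e' i) = e i := fun i => by
    show dE (e' i) = e i
    rw [Module.Basis.map_apply, LinearEquiv.apply_symm_apply]
  ----------------------------------------------------------------------------------------------
  -- Step 1 (7.6 on `c₂`): realise the basis `e` by left-hand discs.
  ----------------------------------------------------------------------------------------------
  have hcritk : ∀ z ∈ criticalSet (𝓡∂ (4 + 1)) g, g z ∈ Icc t₀ t₁ →
      g z = ν₀ ∧ morseIndex (𝓡∂ (4 + 1)) g z = 2 :=
    fun z hz hzI => hg.eq_of_apply_mem_Icc_cutLevel hz hzI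
  have hcritk' : ∀ z ∈ criticalSet (𝓡∂ (4 + 1)) g, g z ∈ Icc t₁ t₂ →
      g z = ν₁ ∧ morseIndex (𝓡∂ (4 + 1)) g z = 3 :=
    fun z hz hzI => hg.eq_of_apply_mem_Icc_cutLevel hz hzI
  have hνt : ∀ j m, Cobordism.niceLevel 4 j ≠ Cobordism.cutLevel 4 m := Cobordism.niceLevel_ne_cutLevel 4
  have hregg : ∀ z ∈ criticalSet (𝓡∂ (4 + 1)) g, g z ≠ t₀ ∧ g z ≠ t₁ := fun z hz => by
    rw [hg.2 z hz]; exact ⟨hνt _ _, hνt _ _⟩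
  -- connectivity of the two slabs (simple connectivity of levels and slabs, Remark 1 after 6.4)
  have hreg : ∀ k, ∀ z ∈ criticalSet (𝓡∂ (4 + 1)) g, g z ≠ Cobordism.plusLevel 4 k :=
    fun k z hz h => hg.not_isMCriticalPt_of_apply_eq_plusLevel h hz
  have hplus : ∀ k, k ≤ 4 → Cobordism.plusLevel 4 k ∈ Ioo (0 : ℝ) 1 := fun k hk =>
    ⟨Cobordism.plusLevel_pos 4 k, Cobordism.plusLevel_lt_one hk⟩
  have hmin : ∀ z ∈ criticalSet (𝓡∂ (4 + 1)) g, 2 ≤ morseIndex (𝓡∂ (4 + 1)) g z := fun z hz => by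
    rcases h23 z hz with h | h <;> omega
  have hwin : ∀ z ∈ criticalSet (𝓡∂ (4 + 1)) g, 2 ≤ morseIndex (𝓡∂ (4 + 1)) g z ∧
      morseIndex (𝓡∂ (4 + 1)) g z ≤ (4 + 1) - 2 := fun z hz => by
    rcases h23 z hz with h | h <;> omega
  have hlev1 : SimplyConnectedSpace ↥(g ⁻¹' {Cobordism.plusLevel 4 1}) := by
    obtain ⟨h1, -, -⟩ := Cobordism.Milnor1965_simplyConnected_levels_holds hc hW hgM (hplus 1 (by omega)) (hreg 1)
    refine h1 fun z hz hlt => ?_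
    have := hg.morseIndex_le_of_apply_lt_plusLevel hz hlt
    have := hmin z hz
    omega
  have hlev2 : SimplyConnectedSpace ↥(g ⁻¹' {Cobordism.plusLevel 4 2}) := by
    obtain ⟨h1, -, -⟩ := Cobordism.Milnor1965_simplyConnected_levels_holds hc hW hgM (hplus 2 (by omega)) (hreg 2)
    refine h1 fun z hz hlt => ?_
    have := hg.morseIndex_le_of_apply_lt_plusLevel hz hlt
    exact ⟨hmin z hz, by omega⟩
  have hslab1 : SimplyConnectedSpace ↥(g ⁻¹' Icc (Cobordism.plusLevel 4 1) (Cobordism.plusLevel 4 2)) := by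
    obtain ⟨-, -, h3⟩ := Cobordism.Milnor1965_simplyConnected_levels_holds hc hW hgM (hplus 1 (by omega)) (hreg 1)
    exact h3 (Cobordism.plusLevel_strictMono 4 (by omega)) (hplus 2 (by omega)).2 (hreg 2) hlev1
      fun z hz _ => (hwin z hz).1
  have hslab2 : SimplyConnectedSpace ↥(g ⁻¹' Icc (Cobordism.plusLevel 4 2) (Cobordism.plusLevel 4 3)) := by
    obtain ⟨-, -, h3⟩ := Cobordism.Milnor1965_simplyConnected_levels_holds hc hW hgM (hplus 2 (by omega)) (hreg 2)
    exact h3 (Cobordism.plusLevel_strictMono 4 (by omega)) (hplus 3 (by omega)).2 (hreg 3) hlev2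
      fun z hz _ => (hwin z hz).1
  have hcut : ∀ k, Cobordism.cutLevel 4 (k + 1) = Cobordism.plusLevel 4 k := Cobordism.cutLevel_succ 4
  have hconn₁ : IsConnected (g ⁻¹' Icc t₀ t₁) := by
    rw [ht₀d, ht₁d, hcut 1, hcut 2]
    exact isConnected_iff_connectedSpace.mpr inferInstance
  have hconn₂ : IsConnected (g ⁻¹' Icc t₁ t₂) := by
    rw [ht₁d, ht₂d, hcut 2, hcut 3]
    exact isConnected_iff_connectedSpace.mpr inferInstance
  -- the basis `e` of `C₂` read in `H₂(c₂, V)` along the isomorphism of PDF p. 46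
  haveI hΦ₁ := Cobordism.Milnor1965_slabHomology_iso_holds hgM ht0 ht₀t₁ hregg 2
  set eθ := e.map (asIso (relativeSingularHomology.map ℤ ℤ (slabToSublevel g t₀ t₁)
    (mapsTo_slabToSublevel g t₀ t₁) 2)).toLinearEquiv.symm with heθd
  obtain ⟨g', ξ', hg', hξ', hnear₁, hin₁, hcrit₁, hind₁, ⟨b₁, hb₁, hlev₁⟩, σ, hσ, hσr, hdisc₁'⟩ :=
    h76 hgM ξ hξ ht0.le ht₀ν₀ hν₀t₁ ht₁1.le (le_refl 2) (by norm_num) hcritk hconn₁ eθ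
  have hdisc₁ : ∀ i, ∃ (h₁ : leftHandDisc (𝓡∂ (4 + 1)) g' ξ' (σ i) t₀ ⊆ {z | g z ≤ t₁})
      (h₀ : MapsTo (Set.inclusion h₁)
        (Subtype.val ⁻¹' leftHandSphere (𝓡∂ (4 + 1)) g' ξ' (σ i) t₀)
        {z : ↥{z : c.W | g z ≤ t₁} | g z.1 ≤ t₀}),
      ∃ γ, (relativeSingularHomology.map ℤ ℤ
        (⟨Set.inclusion h₁, continuous_inclusion h₁⟩ :
          C(↥(leftHandDisc (𝓡∂ (4 + 1)) g' ξ' (σ i) t₀), ↥{z : c.W | g z ≤ t₁})) h₀ 2).hom γ =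
        e i := by
    intro i
    obtain ⟨h₁, h₀, γ, hγ⟩ := hdisc₁' i
    obtain ⟨h₁', h₀', h⟩ := exists_map_sublevel_eq_of_map_slab_eq g 2 h₁ h₀ (e i) (γ := γ)
      (by rw [hγ, heθd, Module.Basis.map_apply])
    exact ⟨h₁', h₀', γ, h⟩
  have heq₁ : ∀ z, g z ∉ Ioo t₀ t₁ → g' z = g z := fun z hz => (hnear₁.self_of_nhdsSet z hz).1
  have hξeq₁ : ∀ z, g z ∉ Ioo t₀ t₁ → ξ' z = ξ z := fun z hz => (hnear₁.self_of_nhdsSet z hz).2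
  have hg'd : MDifferentiable (𝓡∂ (4 + 1)) 𝓘(ℝ, ℝ) g' := hg'.isMorse.contMDiff.mdifferentiable (by simp)
  -- the sublevel sets and slabs bounded by `t₀, t₁, t₂` are unchanged
  have hα₀ : ∀ z, g z ≤ t₀ ↔ g' z ≤ t₀ := le_iff_le_of_alteration heq₁ hin₁ (Or.inl le_rfl)
  have hα₁ : ∀ z, g z ≤ t₁ ↔ g' z ≤ t₁ := le_iff_le_of_alteration heq₁ hin₁ (Or.inr le_rfl)
  have hα₂ : ∀ z, g z ≤ t₂ ↔ g' z ≤ t₂ := le_iff_le_of_alteration heq₁ hin₁ (Or.inr ht₁t₂.le)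
  have hαI₁ : ∀ z, g z ∈ Icc t₀ t₁ ↔ g' z ∈ Icc t₀ t₁ :=
    mem_Icc_iff_of_alteration_of_subset heq₁ hin₁ Ioo_subset_Icc_self
  have hαI₂ : ∀ z, g z ∈ Icc t₁ t₂ ↔ g' z ∈ Icc t₁ t₂ :=
    mem_Icc_iff_of_alteration_of_le heq₁ hin₁ (Or.inr le_rfl)
  have hσcrit : ∀ z ∈ range σ, z ∈ criticalSet (𝓡∂ (4 + 1)) g ∧ g z ∈ Icc t₀ t₁ := fun z hz => by
    rw [hσr] at hz; exact hz
  ----------------------------------------------------------------------------------------------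
  -- Step 2 (7.6 on `c₃`, for `g'`, `ξ'`): realise the basis `e'` by left-hand discs.
  ----------------------------------------------------------------------------------------------
  have hcrit₁' : ∀ z ∈ criticalSet (𝓡∂ (4 + 1)) g', g' z ∈ Icc t₁ t₂ →
      g' z = ν₁ ∧ morseIndex (𝓡∂ (4 + 1)) g' z = 3 := by
    intro z hz hzI
    rw [hcrit₁] at hz
    have hzI' : g z ∈ Icc t₁ t₂ := (hαI₂ z).2 hzI
    obtain ⟨hv, hi⟩ := hcritk' z hz hzI'
    exact ⟨(heq₁ z fun h => (not_lt.2 hzI'.1) h.2).trans hv, (hind₁ z hz).trans hi⟩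
  have hconn₂' : IsConnected (g' ⁻¹' Icc t₁ t₂) := by
    have : g' ⁻¹' Icc t₁ t₂ = g ⁻¹' Icc t₁ t₂ := by ext z; exact (hαI₂ z).symm
    rw [this]; exact hconn₂
  set e'α := e'.map (sublevelCongrIso hα₁ hα₂ 3).toLinearEquiv with he'αd
  have hregg' : ∀ z ∈ criticalSet (𝓡∂ (4 + 1)) g', g' z ≠ t₁ ∧ g' z ≠ t₂ := by
    intro z hz
    rw [hcrit₁] at hz
    by_cases hzI : g z ∈ Icc t₀ t₁
    · rw [hlev₁ z hz hzI]
      exact ⟨hb₁.2.ne, (hb₁.2.trans ht₁t₂).ne⟩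
    · rw [heq₁ z fun h => hzI (Ioo_subset_Icc_self h), hg.2 z hz]
      exact ⟨hνt _ _, hνt _ _⟩
  haveI hΦ₂ := Cobordism.Milnor1965_slabHomology_iso_holds hg' (ht0.trans ht₀t₁) ht₁t₂ hregg' 3
  set e'θ := e'α.map (asIso (relativeSingularHomology.map ℤ ℤ (slabToSublevel g' t₁ t₂)
    (mapsTo_slabToSublevel g' t₁ t₂) 3)).toLinearEquiv.symm with he'θd
  obtain ⟨g₂, ξ₂, hg₂, hξ₂, hnear₂, hin₂, hcrit₂, hind₂, ⟨b₂, hb₂, hlev₂⟩, τ, hτ, hτr, hdisc₂'⟩ :=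
    h76 hg' ξ' hξ' (ht0.trans ht₀t₁).le ht₁ν₁ hν₁t₂ ht₂1.le (by norm_num) (by norm_num) hcrit₁' hconn₂' e'θ
  have hdisc₂ : ∀ i, ∃ (h₁ : leftHandDisc (𝓡∂ (4 + 1)) g₂ ξ₂ (τ i) t₁ ⊆ {z | g' z ≤ t₂})
      (h₀ : MapsTo (Set.inclusion h₁)
        (Subtype.val ⁻¹' leftHandSphere (𝓡∂ (4 + 1)) g₂ ξ₂ (τ i) t₁)
        {z : ↥{z : c.W | g' z ≤ t₂} | g' z.1 ≤ t₁}),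
      ∃ γ, (relativeSingularHomology.map ℤ ℤ
        (⟨Set.inclusion h₁, continuous_inclusion h₁⟩ :
          C(↥(leftHandDisc (𝓡∂ (4 + 1)) g₂ ξ₂ (τ i) t₁), ↥{z : c.W | g' z ≤ t₂})) h₀ 3).hom γ =
        e'α i := by
    intro i
    obtain ⟨h₁, h₀, γ, hγ⟩ := hdisc₂' i
    obtain ⟨h₁', h₀', h⟩ := exists_map_sublevel_eq_of_map_slab_eq g' 3 h₁ h₀ (e'α i) (γ := γ)
      (by rw [hγ, he'θd, Module.Basis.map_apply])
    exact ⟨h₁', h₀', γ, h⟩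
  have heq₂ : ∀ z, g' z ∉ Ioo t₁ t₂ → g₂ z = g' z := fun z hz => (hnear₂.self_of_nhdsSet z hz).1
  have hξeq₂ : ∀ z, g' z ∉ Ioo t₁ t₂ → ξ₂ z = ξ' z := fun z hz => (hnear₂.self_of_nhdsSet z hz).2
  have hβ₀ : ∀ z, g' z ≤ t₀ ↔ g₂ z ≤ t₀ := le_iff_le_of_alteration heq₂ hin₂ (Or.inl ht₀t₁.le)
  have hβ₁ : ∀ z, g' z ≤ t₁ ↔ g₂ z ≤ t₁ := le_iff_le_of_alteration heq₂ hin₂ (Or.inl le_rfl)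
  have hβ₂ : ∀ z, g' z ≤ t₂ ↔ g₂ z ≤ t₂ := le_iff_le_of_alteration heq₂ hin₂ (Or.inr le_rfl)
  have hβI₁ : ∀ z, g' z ∈ Icc t₀ t₁ ↔ g₂ z ∈ Icc t₀ t₁ :=
    mem_Icc_iff_of_alteration_of_le heq₂ hin₂ (Or.inl le_rfl)
  have hβI₂ : ∀ z, g' z ∈ Icc t₁ t₂ ↔ g₂ z ∈ Icc t₁ t₂ :=
    mem_Icc_iff_of_alteration_of_subset heq₂ hin₂ Ioo_subset_Icc_self
  have hτcrit : ∀ z ∈ range τ, z ∈ criticalSet (𝓡∂ (4 + 1)) g' ∧ g' z ∈ Icc t₁ t₂ := fun z hz => by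
    rw [hτr] at hz; exact hz
  have hcrit₂g : criticalSet (𝓡∂ (4 + 1)) g₂ = criticalSet (𝓡∂ (4 + 1)) g := hcrit₂.trans hcrit₁
  have hg₂d : MDifferentiable (𝓡∂ (4 + 1)) 𝓘(ℝ, ℝ) g₂ := hg₂.isMorse.contMDiff.mdifferentiable (by simp)
  -- values of `g₂` at the critical points
  have hval₂σ : ∀ z ∈ range σ, g₂ z = b₁ := by
    intro z hz
    obtain ⟨hzc, hzI⟩ := hσcrit z hz
    have h1 : g' z = b₁ := hlev₁ z hzc hzI
    rw [heq₂ z (by rw [h1]; exact fun h => lt_asymm h.1 hb₁.2), h1]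
  have hval₂τ : ∀ z ∈ range τ, g₂ z = b₂ := by
    intro z hz
    obtain ⟨hzc, hzI⟩ := hτcrit z hz
    exact hlev₂ z hzc hzI
  -- the enumerations `σ`, `τ` are onto the index-2 / index-3 points
  have hσr' : range σ = criticalSetOfIndex (𝓡∂ (4 + 1)) g 2 := by
    rw [hσr]
    ext z
    simp only [mem_inter_iff, mem_preimage, mem_criticalSetOfIndex]
    constructor
    · rintro ⟨hz, hzI⟩
      exact ⟨hz, (hcritk z hz hzI).2⟩
    · rintro ⟨hz, hidx⟩
      refine ⟨hz, ?_⟩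
      rw [hg.2 z hz, hidx]
      exact ⟨ht₀ν₀.le, hν₀t₁.le⟩
  have hτr' : range τ = criticalSetOfIndex (𝓡∂ (4 + 1)) g 3 := by
    rw [hτr]
    ext z
    simp only [mem_inter_iff, mem_preimage, mem_criticalSetOfIndex]
    rw [hcrit₁]
    constructor
    · rintro ⟨hz, hzI⟩
      exact ⟨hz, (hcritk' z hz ((hαI₂ z).2 hzI)).2⟩
    · rintro ⟨hz, hidx⟩
      refine ⟨hz, (hαI₂ z).1 ?_⟩
      rw [hg.2 z hz, hidx]
      exact ⟨ht₁ν₁.le, hν₁t₂.le⟩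
  ----------------------------------------------------------------------------------------------
  -- The static data.
  ----------------------------------------------------------------------------------------------
  refine ⟨g₂, ξ₂, a, σ, τ, b₁, b₂, hg₂, hξ₂, hcrit₂g, fun z hz => ?_, ?_, ?_, ?_, hσ, hσr', fun i => hval₂σ _ ⟨i, rfl⟩,
    hτ, hτr', fun i => hval₂τ _ ⟨i, rfl⟩, ?_⟩
  · -- indices
    have hz₁ : z ∈ criticalSet (𝓡∂ (4 + 1)) g' := by rw [hcrit₁]; exact hz
    rw [hind₂ z hz₁, hind₁ z hz]
  · -- `g₂ = g`, `ξ₂ = ξ` near the middle level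
    have h1 : g ⁻¹' {2⁻¹} ⊆ {z | g z ∉ Ioo t₀ t₁} := fun z hz h => by
      rw [mem_preimage, mem_singleton_iff] at hz
      rw [hz, ht₁v] at h
      exact lt_irrefl _ h.2
    have h2 : g ⁻¹' {2⁻¹} ⊆ {z | g' z ∉ Ioo t₁ t₂} := fun z hz h => by
      rw [mem_preimage, mem_singleton_iff] at hz
      have : g' z = g z := heq₁ z (h1 hz)
      rw [this, hz, ht₁v] at h
      exact lt_irrefl _ h.1
    filter_upwards [hnear₁.filter_mono (nhdsSet_mono h1), hnear₂.filter_mono (nhdsSet_mono h2)] with z hz1 hz2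
    exact ⟨hz2.1.trans hz1.1, hz2.2.trans hz1.2⟩
  · -- the middle level is unchanged
    ext z
    simp only [mem_preimage, mem_singleton_iff]
    rw [← ht₁v, ← apply_eq_iff_apply_eq_of_alteration heq₂ hin₂ (fun h => lt_irrefl _ h.1) z,
      ← apply_eq_iff_apply_eq_of_alteration heq₁ hin₁ (fun h => lt_irrefl _ h.2) z]
  · rw [← ht₂v, ← ht₁v, ← ht₀v]
    exact ⟨hb₁.1, hb₁.2, hb₂.1, hb₂.2⟩
  ----------------------------------------------------------------------------------------------
  -- The per-pair computation.
  ----------------------------------------------------------------------------------------------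
  intro ξ₃ hξ₃ hξ₃eq V _ _ _ _ _ _ ι hι hιr j i eR heR hSR eL heL hSL hfin htr oV oR oL
  have hg₂M := hg₂
  ----------------------------------------------------------------------------------------------
  -- Fields: `ξ₃ = ξ₂ = ξ'` on `{g' ≤ b₁}`; `ξ₃ = ξ₂` on `{g₂ ≥ t₁}`.
  ----------------------------------------------------------------------------------------------
  have hξ₃₂_low : ∀ z, g₂ z ≤ b₁ → ξ₃ z = ξ₂ z := fun z hz => hξ₃eq z fun h => (not_lt.2 hz) h.1
  have hξ₃₂_high : ∀ z, t₁ ≤ g₂ z → ξ₃ z = ξ₂ z := fun z hz =>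
    hξ₃eq z fun h => (not_lt.2 hz) (by rw [ht₁v]; exact h.2)
  have hξ₂'_low : ∀ z, g' z ≤ t₁ → ξ₂ z = ξ' z := fun z hz => hξeq₂ z fun h => (not_lt.2 hz) h.1
  ----------------------------------------------------------------------------------------------
  -- Step 3 (4.1/4.2 on `c₂`, keeping `ξ₃`): raise `p = σ j` to `aP`, the others to `ν₀`.
  ----------------------------------------------------------------------------------------------
  set p := σ j with hpd
  have hpσ : p ∈ range σ := ⟨j, rfl⟩
  set aP : ℝ := (ν₀ + t₁) / 2 with haPd
  have haP₁ : ν₀ < aP := by rw [haPd]; linarith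
  have haP₂ : aP < t₁ := by rw [haPd]; linarith
  have hσrange_eq : insert p (range σ \ {p}) = range σ := by
    rw [insert_sdiff_singleton, insert_eq_of_mem hpσ]
  obtain ⟨g₄, hg₄, hξ₄, hcrit₄, hind₄, hp₄, hQ₄, heq₄, hin₄⟩ :=
    Cobordism.exists_isolate_criticalPt_of_parts Cobordism.Milnor1965_rearrangement_slab_holds
      Cobordism.Milnor1965_rearrangement_slab_oneLevel_holds hg₂ ξ₃ hξ₃ (bb := b₁) ht0 hb₁.1 hb₁.2
      ht₁1 ⟨ht₀ν₀.trans haP₁, haP₂⟩ ⟨ht₀ν₀, hν₀t₁⟩ (p := p) (Q := range σ \ {p})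
      (by rw [hcrit₂g]; exact (hσcrit p hpσ).1)
      (fun z hz => by rw [hcrit₂g]; exact (hσcrit z hz.1).1) (fun h => h.2 rfl)
      (fun z hz => by rw [hσrange_eq] at hz; exact hval₂σ z hz)
      (by
        intro z hz hzI
        rw [hσrange_eq, hσr]
        rw [hcrit₂g] at hz
        exact ⟨hz, (hαI₁ z).2 ((hβI₁ z).2 hzI)⟩)
  have hγ₀ : ∀ z, g₂ z ≤ t₀ ↔ g₄ z ≤ t₀ := le_iff_le_of_alteration heq₄ hin₄ (Or.inl le_rfl)
  have hγ₁ : ∀ z, g₂ z ≤ t₁ ↔ g₄ z ≤ t₁ := le_iff_le_of_alteration heq₄ hin₄ (Or.inr le_rfl)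
  have hγ₂ : ∀ z, g₂ z ≤ t₂ ↔ g₄ z ≤ t₂ := le_iff_le_of_alteration heq₄ hin₄ (Or.inr ht₁t₂.le)
  have hlevel₄ : ∀ z, g₂ z = t₁ ↔ g₄ z = t₁ :=
    apply_eq_iff_apply_eq_of_alteration heq₄ hin₄ (fun h => lt_irrefl _ h.2)
  have hcritg₄ : criticalSet (𝓡∂ (4 + 1)) g₄ = criticalSet (𝓡∂ (4 + 1)) g := hcrit₄.trans hcrit₂g
  have hg₄d : MDifferentiable (𝓡∂ (4 + 1)) 𝓘(ℝ, ℝ) g₄ := hg₄.isMorse.contMDiff.mdifferentiable (by simp)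
  -- combined identifications of the sublevel sets at `t₀, t₁, t₂`
  have hB₀ : ∀ z, g' z ≤ t₀ ↔ g₄ z ≤ t₀ := fun z => (hβ₀ z).trans (hγ₀ z)
  have hB₁ : ∀ z, g' z ≤ t₁ ↔ g₄ z ≤ t₁ := fun z => (hβ₁ z).trans (hγ₁ z)
  have hB₂ : ∀ z, g' z ≤ t₂ ↔ g₄ z ≤ t₂ := fun z => (hβ₂ z).trans (hγ₂ z)
  have hA₀ : ∀ z, g z ≤ t₀ ↔ g₄ z ≤ t₀ := fun z => (hα₀ z).trans (hB₀ z)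
  have hA₁ : ∀ z, g z ≤ t₁ ↔ g₄ z ≤ t₁ := fun z => (hα₁ z).trans (hB₁ z)
  have hA₂ : ∀ z, g z ≤ t₂ ↔ g₄ z ≤ t₂ := fun z => (hα₂ z).trans (hB₂ z)
  ----------------------------------------------------------------------------------------------
  -- The critical points and values of `g₄`.
  ----------------------------------------------------------------------------------------------
  have hp₄v : g₄ p = aP := hp₄
  have hQ₄v : ∀ z ∈ range σ, z ≠ p → g₄ z = ν₀ := fun z hz hzp => hQ₄ z ⟨hz, hzp⟩
  have hτ₄v : ∀ z ∈ range τ, g₄ z = b₂ := by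
    intro z hz
    have h2 : g₂ z = b₂ := hval₂τ z hz
    rw [heq₄ z (by rw [h2]; exact fun h => lt_asymm h.2 hb₂.1), h2]
  have hmaster : ∀ z ∈ criticalSet (𝓡∂ (4 + 1)) g₄,
      (z = p ∧ g₄ z = aP) ∨ (z ∈ range σ ∧ z ≠ p ∧ g₄ z = ν₀) ∨ (z ∈ range τ ∧ g₄ z = b₂) := by
    intro z hz
    rw [hcritg₄] at hz
    rcases h23 z hz with h2 | h3
    · have hzσ : z ∈ range σ := by rw [hσr']; exact ⟨hz, h2⟩
      by_cases hzp : z = p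
      · exact Or.inl ⟨hzp, by rw [hzp, hp₄v]⟩
      · exact Or.inr (Or.inl ⟨hzσ, hzp, hQ₄v z hzσ hzp⟩)
    · have hzτ : z ∈ range τ := by rw [hτr']; exact ⟨hz, h3⟩
      exact Or.inr (Or.inr ⟨hzτ, hτ₄v z hzτ⟩)
  have hindg₄ : ∀ z ∈ criticalSet (𝓡∂ (4 + 1)) g,
      morseIndex (𝓡∂ (4 + 1)) g₄ z = morseIndex (𝓡∂ (4 + 1)) g z := by
    intro z hz
    have hz₁ : z ∈ criticalSet (𝓡∂ (4 + 1)) g' := by rw [hcrit₁]; exact hz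
    have hz₂ : z ∈ criticalSet (𝓡∂ (4 + 1)) g₂ := by rw [hcrit₂]; exact hz₁
    rw [hind₄ z hz₂, hind₂ z hz₁, hind₁ z hz]
  have hindσ : ∀ z ∈ range σ, morseIndex (𝓡∂ (4 + 1)) g₄ z = 2 := fun z hz => by
    have := hz; rw [hσr'] at this
    rw [hindg₄ z this.1, this.2]
  have hindτ : ∀ z ∈ range τ, morseIndex (𝓡∂ (4 + 1)) g₄ z = 3 := fun z hz => by
    have := hz; rw [hτr'] at this
    rw [hindg₄ z this.1, this.2]
  ----------------------------------------------------------------------------------------------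
  -- The level `a₀` and Cor. 3.15 on the slabs `[a₀, t₁]` and `[t₀, a₀]` of `g₄`.
  ----------------------------------------------------------------------------------------------
  set a₀ : ℝ := (ν₀ + aP) / 2 with ha₀d
  have ha₀₁ : ν₀ < a₀ := by rw [ha₀d]; linarith
  have ha₀₂ : a₀ < aP := by rw [ha₀d]; linarith
  have ha₀pos : 0 < a₀ := ht0.trans (ht₀ν₀.trans ha₀₁)
  have hpc₄ : p ∈ criticalSet (𝓡∂ (4 + 1)) g₄ := by rw [hcritg₄]; exact (hσcrit p hpσ).1
  have hcritBA : ∀ z ∈ criticalSet (𝓡∂ (4 + 1)) g₄, g₄ z ∈ Icc a₀ t₁ →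
      g₄ z = aP ∧ morseIndex (𝓡∂ (4 + 1)) g₄ z = 2 := by
    intro z hz hzI
    rcases hmaster z hz with ⟨rfl, hv⟩ | ⟨hzσ, -, hv⟩ | ⟨-, hv⟩
    · exact ⟨hv, hindσ _ hpσ⟩
    · exfalso; rw [hv] at hzI; linarith [hzI.1]
    · exfalso; rw [hv] at hzI; linarith [hzI.2, hb₂.1]
  have honly₄ : ∀ z ∈ criticalSet (𝓡∂ (4 + 1)) g₄, g₄ z ∈ Icc a₀ t₁ → z = p := by
    intro z hz hzI
    rcases hmaster z hz with ⟨h, -⟩ | ⟨-, -, hv⟩ | ⟨-, hv⟩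
    · exact h
    · exfalso; rw [hv] at hzI; linarith [hzI.1]
    · exfalso; rw [hv] at hzI; linarith [hzI.2, hb₂.1]
  have hsetBA : criticalSet (𝓡∂ (4 + 1)) g₄ ∩ g₄ ⁻¹' Icc a₀ t₁ = {p} := by
    ext z
    simp only [mem_inter_iff, mem_preimage, mem_singleton_iff]
    constructor
    · rintro ⟨hz, hzI⟩
      exact honly₄ z hz hzI
    · rintro rfl
      exact ⟨hpc₄, by rw [hp₄v]; exact ⟨ha₀₂.le, haP₂.le⟩⟩
  obtain ⟨hBAc, hBAfree, hBAfin, hBArk⟩ :=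
    Cobordism.Milnor1965_homology_oneLevel_slab_holds hg₄ (b := aP) (k := 2) ha₀pos.le ha₀₂ haP₂ ht₁1.le hcritBA
  rw [hsetBA, ncard_singleton] at hBArk
  have hcritAW : ∀ z ∈ criticalSet (𝓡∂ (4 + 1)) g₄, g₄ z ∈ Icc t₀ a₀ →
      g₄ z = ν₀ ∧ morseIndex (𝓡∂ (4 + 1)) g₄ z = 2 := by
    intro z hz hzI
    rcases hmaster z hz with ⟨-, hv⟩ | ⟨hzσ, -, hv⟩ | ⟨-, hv⟩
    · exfalso; rw [hv] at hzI; linarith [hzI.2]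
    · exact ⟨hv, hindσ z hzσ⟩
    · exfalso; rw [hv] at hzI; linarith [hzI.2, hb₂.1]
  obtain ⟨hAWc, -, -, -⟩ :=
    Cobordism.Milnor1965_homology_oneLevel_slab_holds hg₄ (b := ν₀) (k := 2) ht0.le ht₀ν₀ ha₀₁
      (ha₀₂.trans (haP₂.trans ht₁1)).le hcritAW
  have hAW : IsZero (sublevelHomology g₄ t₀ a₀ 1) := hAWc 1 (by omega)
  have hregs₄ : ∀ z ∈ criticalSet (𝓡∂ (4 + 1)) g₄, g₄ z ≠ a₀ ∧ g₄ z ≠ t₁ := by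
    intro z hz
    rcases hmaster z hz with ⟨-, hv⟩ | ⟨-, -, hv⟩ | ⟨-, hv⟩
    · rw [hv]; constructor <;> linarith
    · rw [hv]; constructor <;> linarith
    · rw [hv]; constructor <;> linarith [hb₂.1]
  ----------------------------------------------------------------------------------------------
  -- The bases transported to the sublevel filtration of `g₄`; `∂ e'ᵢ = eᵢ` there.
  ----------------------------------------------------------------------------------------------
  set e₄ := e.map (sublevelCongrIso hA₀ hA₁ 2).toLinearEquiv with he₄d
  set e'₄ := e'.map (sublevelCongrIso hA₁ hA₂ 3).toLinearEquiv with he'₄d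
  have he₄ : ∀ m, e₄ m = (sublevelCongr hA₀ hA₁ 2).hom (e m) := fun m => by
    rw [he₄d, Module.Basis.map_apply]; rfl
  have he'₄ : ∀ m, e'₄ m = (sublevelCongr hA₁ hA₂ 3).hom (e' m) := fun m => by
    rw [he'₄d, Module.Basis.map_apply]; rfl
  have hrel₄ : ∀ m, (sublevelBoundary g₄ t₀ t₁ t₂ 2).hom (e'₄ m) = e₄ m := fun m => by
    have hnat := sublevelBoundary_comp_sublevelCongr (g := g) (g₁ := g₄) hA₀ hA₁ hA₂ 2
    have := congrArg (fun φ => (ModuleCat.Hom.hom φ) (e' m)) hnat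
    simp only [ModuleCat.hom_comp, LinearMap.comp_apply] at this
    rw [he'₄, he₄, ← this]
    exact congrArg _ (hrel m)
  -- `ρ : C₂ → H₂(B, A)`
  set ρ := sublevelRelax g₄ (ht₀ν₀.trans ha₀₁).le t₁ 2 with hρd
  ----------------------------------------------------------------------------------------------
  -- `ρ` kills `e m` for `m ≠ j`: the left-hand discs of the other index-2 points lie in `A`.
  ----------------------------------------------------------------------------------------------
  have hkill : ∀ m, m ≠ j → ρ.hom (e₄ m) = 0 := by
    intro m hm
    obtain ⟨hD₁, hD₀, γ, hγ⟩ := hdisc₁ m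
    have hσm : σ m ≠ p := fun h => hm (hσ h)
    -- the disc lies in `A`
    have hDA : ∀ y ∈ leftHandDisc (𝓡∂ (4 + 1)) g' ξ' (σ m) t₀, g₄ y ≤ a₀ := by
      intro y hy
      have hlevm : g' (σ m) = b₁ := hlev₁ (σ m) (hσcrit _ ⟨m, rfl⟩).1 (hσcrit _ ⟨m, rfl⟩).2
      have hy₂ : y ∈ stableSet (𝓡∂ (4 + 1)) (ξ₂ : Π x : c.W, TangentSpace (𝓡∂ (4 + 1)) x) (σ m) :=
        hξ'.stableSet_subset_stableSet_of_eqOn hg'd (t := t₁) (fun z hz => hξ₂'_low z hz)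
          (by rw [hlevm]; exact hb₁.2.le) hy.1
      have hy₃ : y ∈ stableSet (𝓡∂ (4 + 1)) (ξ₃ : Π x : c.W, TangentSpace (𝓡∂ (4 + 1)) x) (σ m) := by
        refine hξ₂.stableSet_subset_stableSet_of_eqOn hg₂d (t := b₁) (fun z hz => hξ₃₂_low z hz) ?_ hy₂
        rw [hval₂σ _ ⟨m, rfl⟩]
      have := hξ₄.apply_le_of_mem_stableSet hg₄d hy₃
      rw [hQ₄v (σ m) ⟨m, rfl⟩ hσm] at this
      exact this.trans ha₀₁.le
    set F : C(↥(leftHandDisc (𝓡∂ (4 + 1)) g' ξ' (σ m) t₀), ↥{z : c.W | g z ≤ t₁}) :=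
      ⟨Set.inclusion hD₁, continuous_inclusion hD₁⟩ with hFd
    set G : C(↥(leftHandDisc (𝓡∂ (4 + 1)) g' ξ' (σ m) t₀), ↥{z : c.W | g₄ z ≤ t₁}) :=
      (sublevelCongrMap hA₁).comp F with hGd
    have hGA : MapsTo G univ {z : ↥{z : c.W | g₄ z ≤ t₁} | g₄ z.1 ≤ a₀} := fun y _ => hDA y.1 y.2
    have hfactor : relativeSingularHomology.map ℤ ℤ F hD₀ 2 ≫ sublevelCongr hA₀ hA₁ 2 ≫ ρ =
        relativeSingularHomology.map ℤ ℤ (ContinuousMap.id _) (mapsTo_univ _ _) 2 ≫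
          relativeSingularHomology.map ℤ ℤ G hGA 2 := by
      rw [← Category.assoc, map_comp_sublevelCongr, hρd, sublevelRelax,
        ← relativeSingularHomology.map_comp, ← relativeSingularHomology.map_comp]
      exact relativeSingularHomology.map_congr ℤ ℤ (by ext y; rfl) _ _ 2
    have hzero : relativeSingularHomology.map ℤ ℤ (ContinuousMap.id _)
        (mapsTo_univ (⇑(ContinuousMap.id ↥(leftHandDisc (𝓡∂ (4 + 1)) g' ξ' (σ m) t₀)))
          (Subtype.val ⁻¹' leftHandSphere (𝓡∂ (4 + 1)) g' ξ' (σ m) t₀)) 2 = 0 :=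
      (isZero_relativeSingularHomology_univ ℤ ℤ 2).eq_of_tgt _ _
    rw [hzero, zero_comp] at hfactor
    have := congrArg (fun φ => (ModuleCat.Hom.hom φ) γ) hfactor
    simp only [ModuleCat.hom_comp, LinearMap.comp_apply, ModuleCat.hom_zero, LinearMap.zero_apply] at this
    rw [he₄, ← hγ]
    exact this
  ----------------------------------------------------------------------------------------------
  -- `ρ` is onto and `H₂(B, A) ≅ ℤ`; `u₁ = ρ (e j)` is a generator.
  ----------------------------------------------------------------------------------------------
  haveI := hBAfree; haveI := hBAfin
  have hρsurj : Function.Surjective ρ.hom := by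
    have hex := sublevel_exact₃ g₄ (ht₀ν₀.trans ha₀₁).le (ha₀₂.trans haP₂).le 1
    have hzero : sublevelBoundary g₄ t₀ a₀ t₁ 1 = 0 := hAW.eq_of_tgt _ _
    haveI : Epi (sublevelRelax g₄ (ht₀ν₀.trans ha₀₁).le t₁ (1 + 1)) := hex.epi_f hzero
    rw [hρd]
    exact (ModuleCat.epi_iff_surjective _).mp inferInstance
  set u₁ := ρ.hom (e₄ j) with hu₁d
  have hspan : Submodule.span ℤ {u₁} = ⊤ := by
    have hle : LinearMap.range ρ.hom ≤ Submodule.span ℤ {u₁} := by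
      rw [LinearMap.range_eq_map, ← e₄.span_eq, Submodule.map_span, Submodule.span_le]
      rintro _ ⟨_, ⟨m, rfl⟩, rfl⟩
      by_cases hm : m = j
      · subst hm
        exact Submodule.subset_span rfl
      · rw [hkill m hm]
        exact Submodule.zero_mem _
    rw [LinearMap.range_eq_top.2 hρsurj] at hle
    exact top_unique hle
  -- a linear equivalence `H₂(B, A) ≃ ℤ` taking `u₁` to `1`
  obtain ⟨εB, hεB⟩ : ∃ εB : sublevelHomology g₄ a₀ t₁ 2 ≃ₗ[ℤ] ℤ, εB u₁ = 1 := by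
    let bB := Module.finBasisOfFinrankEq ℤ (sublevelHomology g₄ a₀ t₁ 2) hBArk
    let φ : sublevelHomology g₄ a₀ t₁ 2 ≃ₗ[ℤ] ℤ := bB.equivFun.trans (LinearEquiv.funUnique (Fin 1) ℤ ℤ)
    have hφ : ∀ x, φ x = bB.repr x 0 := fun x => by
      simp only [φ, LinearEquiv.trans_apply, LinearEquiv.funUnique_apply, Fin.default_eq_zero, Function.eval,
        Module.Basis.equivFun_apply]
    have hmem : bB 0 ∈ Submodule.span ℤ {u₁} := by rw [hspan]; trivial
    obtain ⟨m, hm⟩ := Submodule.mem_span_singleton.1 hmem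
    have hc : m * φ u₁ = 1 := by
      have := congrArg (fun x => bB.repr x 0) hm
      simp only [map_smul, Finsupp.smul_apply, smul_eq_mul, Module.Basis.repr_self,
        Finsupp.single_eq_same] at this
      rw [hφ]; exact this
    rcases Int.eq_one_or_neg_one_of_mul_eq_one' hc with ⟨-, hφ1⟩ | ⟨-, hφ1⟩
    · exact ⟨φ, hφ1⟩
    · exact ⟨φ.trans (LinearEquiv.neg ℤ), by simp [hφ1]⟩
  ----------------------------------------------------------------------------------------------
  -- Naturality: `eᵢ = j⁎ incl⁎ (δ γ'ᵢ)` for the disc `γ'ᵢ` of `τ i`, so `ρ eᵢ = (incl, then (B, A))⁎ sᵢ`.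
  ----------------------------------------------------------------------------------------------
  obtain ⟨hE₁, hE₀, γq, hγq⟩ := hdisc₂ i
  have hSD : leftHandSphere (𝓡∂ (4 + 1)) g₂ ξ₂ (τ i) t₁ ⊆ leftHandDisc (𝓡∂ (4 + 1)) g₂ ξ₂ (τ i) t₁ :=
    leftHandSphere_subset_leftHandDisc
  have hDt₂ : ∀ y ∈ (leftHandDisc (𝓡∂ (4 + 1)) g₂ ξ₂ (τ i) t₁), g₄ y ≤ t₂ := fun y hy => (hB₂ y).1 (hE₁ hy)
  have hSt₁ : ∀ y ∈ (leftHandSphere (𝓡∂ (4 + 1)) g₂ ξ₂ (τ i) t₁), g₄ y = t₁ := fun y hy => by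
    have h2 : g₂ y = t₁ := hy.2
    exact (hlevel₄ y).1 h2
  set Gq : C(↥(leftHandDisc (𝓡∂ (4 + 1)) g₂ ξ₂ (τ i) t₁), ↥{z : c.W | g₄ z ≤ t₂}) := ⟨fun y => ⟨y.1, hDt₂ y.1 y.2⟩, by fun_prop⟩ with hGqd
  have hGq : MapsTo Gq (Subtype.val ⁻¹' (leftHandSphere (𝓡∂ (4 + 1)) g₂ ξ₂ (τ i) t₁)) {z : ↥{z : c.W | g₄ z ≤ t₂} | g₄ z.1 ≤ t₁} :=
    fun y hy => (hSt₁ y.1 hy).le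
  have hGqγ : (relativeSingularHomology.map ℤ ℤ Gq hGq 3).hom γq = e'₄ i := by
    have hcomp : relativeSingularHomology.map ℤ ℤ Gq hGq 3 =
        relativeSingularHomology.map ℤ ℤ (⟨Set.inclusion hE₁, continuous_inclusion hE₁⟩ : C(↥(leftHandDisc (𝓡∂ (4 + 1)) g₂ ξ₂ (τ i) t₁), ↥{z : c.W | g' z ≤ t₂}))
          hE₀ 3 ≫ sublevelCongr hB₁ hB₂ 3 := by
      rw [map_comp_sublevelCongr]
      exact relativeSingularHomology.map_congr ℤ ℤ (by ext y; rfl) _ _ _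
    have := congrArg (fun φ => (ModuleCat.Hom.hom φ) γq) hcomp
    simp only [ModuleCat.hom_comp, LinearMap.comp_apply] at this
    rw [this, hγq, he'αd, Module.Basis.map_apply, he'₄]
    have hcc := sublevelCongr_comp_sublevelCongr (g := g) (g₁ := g') (g₂ := g₄) hα₁ hα₂ hB₁ hB₂ 3
    have := congrArg (fun φ => (ModuleCat.Hom.hom φ) (e' i)) hcc
    simp only [ModuleCat.hom_comp, LinearMap.comp_apply] at this
    exact this
  -- `sᵢ = δ γ'ᵢ ∈ H₂(Sᵢ)` and the inclusion `Sᵢ → B = {g₄ ≤ t₁}`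
  set si := (relativeSingularHomology.δ ℤ ℤ ↥(leftHandDisc (𝓡∂ (4 + 1)) g₂ ξ₂ (τ i) t₁) (Subtype.val ⁻¹' (leftHandSphere (𝓡∂ (4 + 1)) g₂ ξ₂ (τ i) t₁)) 2).hom γq with hsid
  set ιS : C(↥(Subtype.val ⁻¹' (leftHandSphere (𝓡∂ (4 + 1)) g₂ ξ₂ (τ i) t₁) : Set ↥(leftHandDisc (𝓡∂ (4 + 1)) g₂ ξ₂ (τ i) t₁)), ↥{z : c.W | g₄ z ≤ t₁}) :=
    ⟨fun y => ⟨y.1.1, (hSt₁ y.1.1 y.2).le⟩, by fun_prop⟩ with hιSd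
  have hKEY0 : e₄ i = (singularHomology.map ℤ ℤ ιS 2 ≫
      relativeSingularHomology.ofAbsolute ℤ ℤ ↥{z : c.W | g₄ z ≤ t₁} {z | g₄ z.1 ≤ t₀} 2).hom si := by
    rw [← hrel₄ i, ← hGqγ, hsid]
    have hnat : relativeSingularHomology.map ℤ ℤ Gq hGq 3 ≫ sublevelBoundary g₄ t₀ t₁ t₂ 2 =
        relativeSingularHomology.δ ℤ ℤ ↥(leftHandDisc (𝓡∂ (4 + 1)) g₂ ξ₂ (τ i) t₁) (Subtype.val ⁻¹' (leftHandSphere (𝓡∂ (4 + 1)) g₂ ξ₂ (τ i) t₁)) 2 ≫ singularHomology.map ℤ ℤ ιS 2 ≫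
          relativeSingularHomology.ofAbsolute ℤ ℤ ↥{z : c.W | g₄ z ≤ t₁} {z | g₄ z.1 ≤ t₀} 2 := by
      have hmaps : (sublevelIncl g₄ t₁ t₂).comp (subsetRestrict Gq hGq) = ιS := by ext y; rfl
      rw [sublevelBoundary, ← relativeSingularHomology.δ_naturality_assoc, ← singularHomology.map_comp_assoc, hmaps]
    have := congrArg (fun φ => (ModuleCat.Hom.hom φ) γq) hnat
    simp only [ModuleCat.hom_comp, LinearMap.comp_apply] at this
    exact this
  have hKEY1 : ρ.hom (e₄ i) = (singularHomology.map ℤ ℤ ιS 2 ≫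
      relativeSingularHomology.ofAbsolute ℤ ℤ ↥{z : c.W | g₄ z ≤ t₁} {z | g₄ z.1 ≤ a₀} 2).hom si := by
    rw [hKEY0]
    have hcomp : (singularHomology.map ℤ ℤ ιS 2 ≫
        relativeSingularHomology.ofAbsolute ℤ ℤ ↥{z : c.W | g₄ z ≤ t₁} {z | g₄ z.1 ≤ t₀} 2) ≫ ρ =
        singularHomology.map ℤ ℤ ιS 2 ≫
          relativeSingularHomology.ofAbsolute ℤ ℤ ↥{z : c.W | g₄ z ≤ t₁} {z | g₄ z.1 ≤ a₀} 2 := by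
      rw [hρd, sublevelRelax, Category.assoc, relativeSingularHomology.ofAbsolute_comp_map, singularHomology.map_id,
        Category.id_comp]
    have := congrArg (fun φ => (ModuleCat.Hom.hom φ) si) hcomp
    simp only [ModuleCat.hom_comp, LinearMap.comp_apply] at this
    exact this
  ----------------------------------------------------------------------------------------------
  -- The sphere `T = Sᵢ` presented by `ι ∘ eL`; its generator `σ₀`; `sᵢ = m • σ₀` with `m ≠ 0`.
  ----------------------------------------------------------------------------------------------
  set T : Set c.W := range (ι ∘ eL) with hTd
  have hST : (leftHandSphere (𝓡∂ (4 + 1)) g₂ ξ₂ (τ i) t₁) = T := by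
    rw [hSL]
    ext y
    simp only [mem_leftHandSphere_iff]
    constructor
    · rintro ⟨hy, hyv⟩
      have hyv' : t₁ ≤ g₂ y := hyv.symm.le
      exact ⟨hξ₂.mem_stableSet_of_eqOn_ge hg₂d (t := t₁) (fun z hz => hξ₃₂_high z hz) hyv' hy,
        by rw [hyv, ht₁v]⟩
    · rintro ⟨hy, hyv⟩
      have hyv' : g₂ y = t₁ := by rw [hyv, ht₁v]
      exact ⟨hξ₃.mem_stableSet_of_eqOn_ge hg₂d (t := t₁) (fun z hz => (hξ₃₂_high z hz).symm) hyv'.symm.le hy,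
        hyv'⟩
  have hemb : Topology.IsEmbedding (ι ∘ eL) := hι.isEmbedding.comp heL.isEmbedding
  let φT : (Metric.sphere (0 : EuclideanSpace ℝ (Fin 3)) 1) ≃ₜ ↥T := hemb.toHomeomorph
  obtain ⟨σ₀, eσ, hσ₀⟩ := exists_generator_singularHomology_of_homeomorph_sphere (k := 2) (by omega) φT
  have hTS : ∀ y, y ∈ T → y ∈ (leftHandSphere (𝓡∂ (4 + 1)) g₂ ξ₂ (τ i) t₁) := fun y hy => by rw [hST]; exact hy
  have hST' : ∀ y, y ∈ (leftHandSphere (𝓡∂ (4 + 1)) g₂ ξ₂ (τ i) t₁) → y ∈ T := fun y hy => by rw [← hST]; exact hy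
  set θC : C(↥(Subtype.val ⁻¹' (leftHandSphere (𝓡∂ (4 + 1)) g₂ ξ₂ (τ i) t₁) : Set ↥(leftHandDisc (𝓡∂ (4 + 1)) g₂ ξ₂ (τ i) t₁)), ↥T) := ⟨fun y => ⟨y.1.1, hST' _ y.2⟩, by fun_prop⟩ with hθCd
  set θC' : C(↥T, ↥(Subtype.val ⁻¹' (leftHandSphere (𝓡∂ (4 + 1)) g₂ ξ₂ (τ i) t₁) : Set ↥(leftHandDisc (𝓡∂ (4 + 1)) g₂ ξ₂ (τ i) t₁))) :=
    ⟨fun y => ⟨⟨y.1, hSD (hTS _ y.2)⟩, hTS _ y.2⟩, by fun_prop⟩ with hθC'd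
  have hθθ : θC'.comp θC = ContinuousMap.id _ := by ext y; rfl
  set ιT : C(↥T, ↥{z : c.W | g₄ z ≤ t₁}) :=
    ⟨fun y => ⟨y.1, (hSt₁ y.1 (hTS _ y.2)).le⟩, by fun_prop⟩ with hιTd
  have hιS : ιS = ιT.comp θC := by ext y; rfl
  obtain ⟨m, hm⟩ := exists_eq_zsmul_of_generator eσ hσ₀ ((singularHomology.map ℤ ℤ θC 2).hom si)
  have hKEY1' : ρ.hom (e₄ i) = m • (singularHomology.map ℤ ℤ ιT 2 ≫
      relativeSingularHomology.ofAbsolute ℤ ℤ ↥{z : c.W | g₄ z ≤ t₁} {z | g₄ z.1 ≤ a₀} 2).hom σ₀ := by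
    rw [hKEY1, hιS, singularHomology.map_comp]
    simp only [ModuleCat.hom_comp, LinearMap.comp_apply, Category.assoc]
    rw [hm, map_zsmul, map_zsmul]
  have hm0 : m ≠ 0 := by
    intro hm0
    rw [hm0, zero_smul] at hm
    -- then `sᵢ = 0` (`θC` has a left inverse), hence `eᵢ = 0`
    have hsi : si = 0 := by
      have hback : (singularHomology.map ℤ ℤ θC' 2).hom ((singularHomology.map ℤ ℤ θC 2).hom si) = si := by
        have h1 := singularHomology.map_comp ℤ ℤ θC θC' 2
        rw [hθθ, singularHomology.map_id] at h1
        have := congrArg (fun φ => (ModuleCat.Hom.hom φ) si) h1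
        simp only [ModuleCat.hom_comp, LinearMap.comp_apply, ModuleCat.hom_id, LinearMap.id_apply] at this
        exact this.symm
      rw [← hback, hm, map_zero]
    have : e₄ i = 0 := by rw [hKEY0, hsi, map_zero]
    exact e₄.ne_zero i this
  ----------------------------------------------------------------------------------------------
  -- Lemma 7.2 on the slab `g₄⁻¹[a₀, t₁]` with `M = T`, read in `H₂(B, A)`.
  ----------------------------------------------------------------------------------------------
  have hιr₄ : range ι = g₄ ⁻¹' {t₁} := by
    rw [hιr]
    ext z
    simp only [mem_preimage, mem_singleton_iff]
    rw [← ht₁v]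
    exact hlevel₄ z
  have hSR₄ : range (ι ∘ eR) = rightHandSphere (𝓡∂ (4 + 1)) g₄ ξ₃ p t₁ := by
    rw [hSR]
    ext y
    simp only [mem_rightHandSphere_iff]
    rw [← ht₁v, hlevel₄ y]
  have hTsub : T ⊆ g₄ ⁻¹' Icc a₀ t₁ := fun y hy => by
    have : g₄ y = t₁ := hSt₁ y (hTS y hy)
    rw [mem_preimage, this]
    exact ⟨(ha₀₂.trans haP₂).le, le_rfl⟩
  have hp₄idx : p ∈ criticalSetOfIndex (𝓡∂ (4 + 1)) g₄ 2 := ⟨hpc₄, hindσ p hpσ⟩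
  obtain ⟨u, ⟨eu, heu⟩, h72u⟩ := h72 hg₄ ξ₃ hξ₄ ha₀pos ht₁1 (k := 2) (j := 2) (by norm_num) (le_refl 2)
    (le_refl 4) hp₄idx (by rw [hp₄v]; exact ha₀₂) (by rw [hp₄v]; exact haP₂) honly₄ V ι hι hιr₄ eR heR hSR₄ eL heL
    T rfl hTsub hfin htr oV oR oL σ₀ ⟨eσ, hσ₀⟩
  -- move to `H₂(B, A)` along the isomorphism of PDF p. 46
  haveI hΦ₄ := Cobordism.Milnor1965_slabHomology_iso_holds hg₄ ha₀pos (ha₀₂.trans haP₂) hregs₄ 2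
  set Φ := relativeSingularHomology.map ℤ ℤ (slabToSublevel g₄ a₀ t₁) (mapsTo_slabToSublevel g₄ a₀ t₁) 2 with hΦd
  set N : ℤ := intersectionNumber (𝓡 2) (𝓡 2) (𝓡 4) two_add_two_eq_four oR oL oV eR eL with hNd
  have hKEY2 : (singularHomology.map ℤ ℤ ιT 2 ≫
      relativeSingularHomology.ofAbsolute ℤ ℤ ↥{z : c.W | g₄ z ≤ t₁} {z | g₄ z.1 ≤ a₀} 2).hom σ₀ = N • Φ.hom u := by
    have hcomp : singularHomology.map ℤ ℤ ιT 2 ≫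
        relativeSingularHomology.ofAbsolute ℤ ℤ ↥{z : c.W | g₄ z ≤ t₁} {z | g₄ z.1 ≤ a₀} 2 =
        (singularHomology.map ℤ ℤ (subsetInclusion hTsub) 2 ≫
          relativeSingularHomology.ofAbsolute ℤ ℤ ↥(g₄ ⁻¹' Icc a₀ t₁) {z | g₄ z.1 = a₀} 2) ≫ Φ := by
      rw [hΦd, Category.assoc, relativeSingularHomology.ofAbsolute_comp_map, ← singularHomology.map_comp_assoc]
      rfl
    have h1 := congrArg (fun φ => (ModuleCat.Hom.hom φ) σ₀) hcomp
    simp only [ModuleCat.hom_comp, LinearMap.comp_apply] at h1 ⊢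
    rw [h1]
    have h72v := congrArg Φ.hom h72u
    rw [map_zsmul] at h72v
    exact h72v
  -- `Φ u` is a generator of `H₂(B, A)`: `Φ u = ε • u₁`, `ε = ±1`
  have hΦu : ∃ ε : ℤ, (ε = 1 ∨ ε = -1) ∧ Φ.hom u = ε • u₁ := by
    set ΦL := (asIso Φ).toLinearEquiv with hΦL
    have hgen : ∃ e' : sublevelHomology g₄ a₀ t₁ 2 ≃ₗ[ℤ] ℤ, e' (Φ.hom u) = 1 :=
      ⟨ΦL.symm.trans eu, by simp [hΦL, heu]⟩
    obtain ⟨e', he'⟩ := hgen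
    obtain ⟨ε, hε⟩ := exists_eq_zsmul_of_generator εB hεB (Φ.hom u)
    obtain ⟨ε', hε'⟩ := exists_eq_zsmul_of_generator e' he' u₁
    have h1 : Φ.hom u = (ε * ε') • Φ.hom u := by
      conv_lhs => rw [hε, hε', ← mul_zsmul]
    have h3 : ε * ε' = 1 := by
      have := congrArg e' h1
      rw [map_zsmul, he', smul_eq_mul, mul_one] at this
      exact this.symm
    exact ⟨ε, Int.eq_one_or_neg_one_of_mul_eq_one h3, hε⟩
  obtain ⟨ε, hε1, hεu⟩ := hΦu
  ----------------------------------------------------------------------------------------------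
  -- Conclusion: `m N ε • u₁ = ρ eᵢ = δᵢⱼ • u₁`.
  ----------------------------------------------------------------------------------------------
  have hfinal : ρ.hom (e₄ i) = (m * N * ε) • u₁ := by
    rw [hKEY1', hKEY2, hεu, ← mul_zsmul, ← mul_zsmul]
  refine ⟨fun hij => ?_, fun hij => ?_⟩
  · -- `i = j`: `m N ε = 1`, so `N = ±1`
    subst hij
    have h1 : u₁ = (m * N * ε) • u₁ := hfinal
    have h3 : m * N * ε = 1 := by
      have := congrArg εB h1
      rw [map_zsmul, hεB, smul_eq_mul, mul_one] at this
      exact this.symm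
    have hN : N * (m * ε) = 1 := by linarith [mul_comm m N, mul_assoc N m ε]
    rcases Int.eq_one_or_neg_one_of_mul_eq_one hN with h | h
    · exact Or.inl h
    · exact Or.inr h
  · -- `i ≠ j`: `m N ε = 0` with `m ≠ 0`, `ε ≠ 0`, so `N = 0`
    have h1 : (m * N * ε) • u₁ = 0 := by rw [← hfinal, hkill i hij]
    have h2 : m * N * ε = 0 := by
      have := congrArg εB h1
      rw [map_zsmul, hεB, smul_eq_mul, mul_one, map_zero] at this
      exact this
    have hε0 : ε ≠ 0 := by rcases hε1 with h | h <;> rw [h] <;> norm_num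
    rcases mul_eq_zero.1 h2 with h | h
    · rcases mul_eq_zero.1 h with h' | h'
      · exact absurd h' hm0
      · exact h'
    · exact absurd h hε0

end Slides

end Literature.Topology.FourManifolds

end
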